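import Literature.NumberTheory.EllipticCurves.ComplexMultiplicationBurungaleFlachFiniteLeavesProofs
import Literature.NumberTheory.EllipticCurves.ComplexMultiplicationSingularModuliProofs
import Literature.NumberTheory.EllipticCurves.ComplexMultiplicationDeuringArtinProofs
import Literature.NumberTheory.EllipticCurves.ComplexMultiplicationLFunctionIsogenyProofs
import HarnessLib

/-!
# bsd.S28 (Burungale–Flach): Theorem 1.1 over the CM field from the six terminal leaves of its
decomposition — the census of `BurungaleFlach2024_main_cmField`

Proof-only sibling (D-0014 append protocol: no definition, no statement of the tree restated or
edited) of `ComplexMultiplicationBurungaleFlachCorOneProofs.lean`, whose named fact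
`Literature.NumberTheory.EllipticCurves.BurungaleFlach2024_main_cmField` is Burungale–Flach,
Camb. J. Math. 12 (2024), **Theorem 1.1 with Remark 1 at `F = K`** for the base change `E_K` of a
CM curve `E/ℚ` (`j(E) ∈ maximalCMJInvariants`, `L(E/ℚ,1) ≠ 0`): `E(K)` and `Ш(E/K)` are finite,
`z := L(ψ̄,1)/Ω ∈ K^×` and `z² · #E(K)² = u · #Ш(E/K) · ∏_v c_v` with `u ∈ 𝓞_K^×`.

## The printed proof and the tree's decomposition of it

The paper proves Theorem 1.1 (= "Theorem (main)") in §4.5, last paragraph: *"It suffices to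
produce an element `z` as in Prop. (keyelliptic) [= Prop. 2.3] for all prime numbers `p`. The
content of Lemma (descent5) [= Lemma 13] is precisely that the element `z` satisfies the
assumptions of Prop. (keyelliptic) for `S = {v ∣ p𝔣}`. Since it was shown in Prop. (descent)
[= Prop. 4.1] that the `p`-primary part of `Ш(E/F)` (and of `E(F)`) is finite for any prime `p`,
the finiteness of `Ш(E/F)` follows from the global formula for its cardinality given by
Prop. (keyelliptic). This concludes the proof of Theorem (main)."* Here Prop. 2.3 (§2) is the
reduction, one rational prime `p` at a time, of the `{𝔭 ∣ p}`-part of the formula to a zeta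
element `z ∈ det_{K_p} H¹(𝓞_{F,S}, V_p)` with properties a), b), c) (through Prop. 2.1, the
computation of `det⁻¹ RΓ(𝓞_{F,S}, T_p)` in terms of `Ш[p^∞]`, `E(F)`, `Φ_v`, Euler factors and
differentials, and Lemma 6 on the period); Lemma 13 (§4.5) produces `z` from the two-variable
main conjecture of Johnson-Leung–Kings (Thm. 4.1, §4.2), its descent (Lemma 9 and Prop. 4.1,
§4.3: *"Moreover, the Selmer group `Sel(K, T(φ)(1))` is finite"*) and Kato's explicit
reciprocity law (Prop. 3.1, Cor. 9, §3); Remark 10 attributes the finiteness of `E(F)` to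
Coates–Wiles, Arthaud, Rubin and that of `Ш(E/F)[p^∞]` (for `L = K`) to Rubin (1987); §1 records
that for `𝔭 ∤ #𝓞_K^×` the `𝔭`-primary part at `F = K` is Rubin's theorem of 1991.

The tree follows this proof literally (`ComplexMultiplicationBurungaleFlachPrimaryProofs.lean`,
`…FiniteProofs.lean`): the level-3 leaf is **equivalent** to the conjunction
(`BurungaleFlach2024_main_cmField_iff_halves`, the last paragraph of §4.5 proved in both
directions) of the finiteness half
`BurungaleFlach2024_finite_primary_cmField` (Prop. 4.1 with Remark 10) and the formula half
`BurungaleFlach2024_main_cmField_pPart` (Prop. 2.3 with Lemma 13), and the finiteness half is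
derived from the classical literature (`BurungaleFlach2024_finite_primary_cmField_of_classical`,
and, with the Deuring–Hecke continuation in place of modularity,
`BurungaleFlach2024_finite_primary_cmField_of_hecke` of `…FiniteLeavesProofs.lean`). The
assembly of record so far, `BurungaleFlach2024_main_cmField_of_leaves`
(`…PrimaryLeavesProofs.lean`), derives the level-3 leaf from **eight** named facts, among them the
three singular moduli `d_K = -43, -67, -163`, the six CM twist isogenies and modularity. Two of
these have since become theorems of the tree — the nine singular moduli
(`singularModuli_classNumberOne_holds`, whence Coates–Wiles' Theorem 1 from its `𝔭`-adic core
alone, `finite_point_of_j_mem_maximalCMJInvariants_of_L_one_ne_zero_of_pAdicDivisibility`) and the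
nine twist isogenies `E ∼_ℚ E^{(d_K)}` (`isIsogenous_quadraticTwist_cmFieldDiscr_holds`) — and the
third is stronger than what the proof uses (the continuation of `L(E/ℚ,s)` for the CM curve `E`
only: Deuring–Hecke, `hasEntireLFunction_of_j_mem_maximalCMJInvariants`, Silverman *Advanced
Topics* II Cor. 10.5.1; the paper itself argues with `L(E/F,s) = L(ψ̄,s)L(ψ,s)`, never with
modularity).

## What this file proves

* `BurungaleFlach2024_main_cmField_of_pPart_of_classical` (**proved**): Theorem 1.1 at `F = K`
  from its formula half and the classical named facts (Coates–Wiles finiteness over `ℚ`,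
  Knapp 11.67, Rubin 1987 §10, Deuring, Deuring–Hecke), the twist isogeny being a theorem;
* `BurungaleFlach2024_main_cmField_of_six_leaves` (**proved**): the updated assembly of record —
  Theorem 1.1 at `F = K` from the **six** terminal leaves on which it now rests:
  1. `BurungaleFlach2024_main_cmField_pPart` — Prop. 2.3 with Lemma 13 at `F = K` for every
     rational prime `p` (the theory of the paper: Thm. 4.1, Prop. 4.1, Prop. 3.1/Cor. 9);
  2. `Rubin1987_sha_primary_finite` — Rubin, Invent. Math. 89 (1987), §10: `Ш(E_K/K)[p^∞]` is
     finite for every `p` when `L(E_K/K,1) ≠ 0`;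
  3. `CoatesWiles1977_L_one_div_period_mem_prime` — Coates–Wiles, Invent. Math. 39 (1977), §6:
     the `𝔭`-divisibility of `Ω⁻¹L(E/ℚ,1)` forced by a rational point of infinite order;
  4. `hasEntireLFunction_of_j_mem_maximalCMJInvariants` — Deuring–Hecke: `L(E/ℚ,s)` is entire
     for `E/ℚ` with CM by `𝓞_K`;
  5. `LSeries_baseChange_quadratic` — Artin formalism `L(E_K/K,s) = L(E,s)L(E^{(disc K)},s)`
     (Ireland–Rosen 20.5.4(b)), giving Deuring's `L(E_K/K,s) = L(E/ℚ,s)²` with 6 and the twist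
     isogeny;
  6. `WeierstrassCurve.hasseWeilEulerFactor_geomPoints W ℓ` for elliptic `W/ℚ` and all `ℓ` — the
     Euler factors of Mathlib's `L`-function are those of the Tate module (Serre–Tate 1968,
     Thm. 3), giving Knapp 11.67;
  everything else (Mordell–Weil over `ℚ`, the nine singular moduli and the CM period lattice, the
  nine twist isogenies, the quadratic descent of finiteness, `Ш[p^∞]` and `E(K)` under changes of
  variables, `V_ℓ` along isogenies, the local–global passage from the `{𝔭 ∣ p}`-parts to the
  ideal identity and the finiteness of `Ш(E/K)`) being theorems of the tree;
* `BurungaleFlach2024_main_cmField_iff_pPart` (**proved**): modulo leaves 2–6, Theorem 1.1 at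
  `F = K` is *equivalent* to its formula half 1 — the forward direction needs nothing
  (`BurungaleFlach2024_main_cmField_pPart_of_main`), so what separates the level-3 leaf
  from a theorem of the tree is exactly Prop. 2.3 with Lemma 13, given the five classical leaves;
* `BurungaleFlach2024_main_cmField_of_six_leaves_of_hasEntireLFunction_rat` (bookkeeping): the
  same census fed from the modularity leaf, i.e. `BurungaleFlach2024_main_cmField_of_leaves` with
  its two discharged inputs removed.

No leaf is dischargeable from Mathlib at present: 1 needs Iwasawa cohomology over
`ℤ_p⟦Gal(K(p^∞𝔣)/K)⟧`, determinant functors on perfect complexes, elliptic units and the dual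
exponential map; 2 the Euler system of elliptic units; 3 formal groups, local units and `p`-adic
`L`-functions of `K`; 4 Hecke `L`-functions of Grössencharacters of `K`; 5 and 6 the zeta function
of an elliptic curve over a finite field and the `ℓ`-adic representation (trace of Frobenius).

## Design and faithfulness notes

* Nothing is restated: hypotheses are the tree's named facts, conclusions the tree's level-3
  leaf and its two halves; the finiteness half with the CM continuation is the sibling's
  `BurungaleFlach2024_finite_primary_cmField_of_hecke`, imported, not re-proved.
* Faithfulness cross-check of the level-3 transcription (squared form of the ideal identity,
  justified there by Remark 1): for the curves of the leaf — base changes `E_K` of curves over `ℚ`,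
  on globally minimal models — complex conjugation `τ ∈ Gal(K/ℚ)` acts `τ`-semilinearly on
  `Ш(E_K/K)` and carries `Φ_v` to `Φ_{τv}`, so the fractional ideal
  `T = |Ш|_K ∏_v|Φ_v|_K / (#E(K))` of Theorem 1.1 satisfies `τ(T) = T`, and in a quadratic field
  `I · τ(I) = (N I)`; hence `T² = (#Ш · ∏_v c_v / #E(K)²)` and the printed identity `(z) = T` is
  equivalent to `(z)² = (#Ш ∏_v c_v)/(#E(K))²`, i.e. to the transcribed
  `z² #E(K)² = u · #Ш · ∏_v c_v`, independently of Remark 1 (which is needed only for curves not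
  coming from `ℚ`). The statement of Theorem 1.1, Remark 1, (periodnorm), Cor. 1 and its proof,
  the sentence on `E/K` with `h_K = 1` and Remark 2 were re-read against the arXiv text for this
  file and agree with the level-3 docstring.

## References

* A. Burungale, M. Flach, *The conjecture of Birch and Swinnerton-Dyer for certain elliptic curves
  with complex multiplication*, Camb. J. Math. 12 (2024), no. 2 (arXiv:2206.09874): §1 (Thm. 1.1,
  Remark 1, Cor. 1, Remark 2, and the attribution of the `𝔭 ∤ #𝓞_K^×` part to Rubin 1991), §2
  (Prop. 2.1, Def. 1, Lemma 6, Prop. 2.3), §3 (Prop. 3.1, Cor. 9), §4.2 (Thm. 4.1), §4.3 (Lemma 9,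
  Prop. 4.1, Remark 10), §4.5 (Lemmas 10–13 and the proof of Thm. 1.1). [BurungaleFlach2024]
* K. Rubin, *Tate–Shafarevich groups and L-functions of elliptic curves with complex
  multiplication*, Invent. Math. 89 (1987), §10. [Rubin1987Sha]
* J. Coates, A. Wiles, *On the conjecture of Birch and Swinnerton-Dyer*, Invent. Math. 39 (1977),
  Thm. 1 and §6. [CoatesWiles1977]
* J. H. Silverman, *Advanced Topics in the Arithmetic of Elliptic Curves*, GTM 151 (1994), Ch. II
  Thm. 10.5 and Cor. 10.5.1. [SilvermanATAEC1994]
* K. Ireland, M. Rosen, *A Classical Introduction to Modern Number Theory*, 2nd ed. (1990),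
  Prop. 20.5.4(b). [IrelandRosen1990]
* J.-P. Serre, J. Tate, *Good reduction of abelian varieties*, Ann. of Math. 88 (1968), Thm. 3.
  [SerreTate1968]
* A. W. Knapp, *Elliptic Curves* (1993), Thm. 11.67. [Knapp1993]
-/

noncomputable section

open scoped Classical

namespace Literature.NumberTheory.EllipticCurves

open WeierstrassCurve

/-! ### Theorem 1.1 at `F = K` from its formula half and the classical facts -/

/-- **Theorem 1.1 with Remark 1 at `F = K` from its `p`-part half and the classical named facts.**
The level-3 leaf `BurungaleFlach2024_main_cmField` follows from Burungale–Flach Prop. 2.3 with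
Lemma 13 at `F = K` for every rational prime `p` (`hB`), Rubin 1987 §10 (`hR`), Coates–Wiles'
finiteness over `ℚ` (`hF1`), Knapp 11.67 (`hKn`), Deuring's `L(E_K/K,s) = L(E/ℚ,s)²` (`hD`) and
the Deuring–Hecke continuation (`hH`): the finiteness half by
`BurungaleFlach2024_finite_primary_cmField_of_hecke` (the CM twist isogeny `E ∼_ℚ E^{(d_K)}`
being the theorem `isIsogenous_quadraticTwist_cmFieldDiscr_holds`), the two halves being put
together by the last paragraph of the printed proof (`BurungaleFlach2024_main_cmField_of_halves`).
[cite: BurungaleFlach2024, proof of Thm. 1.1 (§4.5) with Prop. 2.3, Lemma 13, Prop. 4.1, Remark 10] -/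
theorem BurungaleFlach2024_main_cmField_of_pPart_of_classical
    (hB : BurungaleFlach2024_main_cmField_pPart) (hR : Rubin1987_sha_primary_finite)
    (hF1 : finite_point_of_j_mem_maximalCMJInvariants_of_L_one_ne_zero)
    (hKn : LFunction_eq_of_isIsogenous) (hD : Deuring_LFunction_baseChange_cmField)
    (hH : hasEntireLFunction_of_j_mem_maximalCMJInvariants) : BurungaleFlach2024_main_cmField :=
  BurungaleFlach2024_main_cmField_of_halves
    (BurungaleFlach2024_finite_primary_cmField_of_hecke hF1
      isIsogenous_quadraticTwist_cmFieldDiscr_holds hKn hR hD hH)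
    hB

/-! ### The census: Theorem 1.1 at `F = K` from its six terminal leaves -/

/-- **Burungale–Flach, Theorem 1.1 with Remark 1 at `F = K`, from the six terminal leaves of its
decomposition in the tree** (see the module docstring for the provenance of each):
Prop. 2.3 with Lemma 13 at `F = K` for every `p` (`hB`), Rubin 1987 §10 (`hR`), Coates–Wiles 1977
§6 (`h1`), the Deuring–Hecke continuation for CM by `𝓞_K` (`hH`), Artin formalism for quadratic
base change (`hBCL`) and the Euler factors of the Tate module (`hHW`). The derived facts used:
Coates–Wiles' Theorem 1 with Mordell–Weil and the nine singular moduli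
(`finite_point_of_j_mem_maximalCMJInvariants_of_L_one_ne_zero_of_pAdicDivisibility`), Knapp 11.67
(`LFunction_eq_of_isIsogenous_of_hasseWeilEulerFactor_geomPoints`), the nine CM twist isogenies
(`isIsogenous_quadraticTwist_cmFieldDiscr_holds`) and Deuring's identity
(`Deuring_LFunction_baseChange_cmField_of_artinFormalism`).
[cite: BurungaleFlach2024, Thm. 1.1 and Remark 1 (§1), proof of Thm. 1.1 (§4.5)]
[cite: Rubin1987Sha, §10] [cite: CoatesWiles1977, Thm 1 and §6]
[cite: SilvermanATAEC1994, Ch. II Cor. 10.5.1] [cite: IrelandRosen1990, Prop. 20.5.4(b)]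
[cite: SerreTate1968, Thm. 3] -/
theorem BurungaleFlach2024_main_cmField_of_six_leaves
    (hB : BurungaleFlach2024_main_cmField_pPart) (hR : Rubin1987_sha_primary_finite)
    (h1 : CoatesWiles1977_L_one_div_period_mem_prime)
    (hH : hasEntireLFunction_of_j_mem_maximalCMJInvariants) (hBCL : LSeries_baseChange_quadratic)
    (hHW : ∀ (W : WeierstrassCurve ℚ) [W.IsElliptic] (ℓ : ℕ) [Fact ℓ.Prime],
      W.hasseWeilEulerFactor_geomPoints ℓ) :
    BurungaleFlach2024_main_cmField :=
  have hKn : LFunction_eq_of_isIsogenous :=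
    LFunction_eq_of_isIsogenous_of_hasseWeilEulerFactor_geomPoints hHW
  BurungaleFlach2024_main_cmField_of_pPart_of_classical hB hR
    (finite_point_of_j_mem_maximalCMJInvariants_of_L_one_ne_zero_of_pAdicDivisibility h1) hKn
    (Deuring_LFunction_baseChange_cmField_of_artinFormalism hBCL
      isIsogenous_quadraticTwist_cmFieldDiscr_holds hKn)
    hH

/-- **Modulo the five classical leaves, Theorem 1.1 at `F = K` is equivalent to its formula half.**
Given Rubin 1987 §10 (`hR`), Coates–Wiles 1977 §6 (`h1`), the Deuring–Hecke continuation (`hH`),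
Artin formalism (`hBCL`) and the Euler factors of the Tate module (`hHW`), the level-3 leaf
`BurungaleFlach2024_main_cmField` holds iff Burungale–Flach Prop. 2.3 with Lemma 13 holds at
`F = K` for every rational prime `p` (`BurungaleFlach2024_main_cmField_pPart`); the forward
direction is unconditional (`BurungaleFlach2024_main_cmField_pPart_of_main`), the backward one is
`BurungaleFlach2024_main_cmField_of_six_leaves`.
[cite: BurungaleFlach2024, proof of Thm. 1.1 (§4.5) with Prop. 2.3 and Lemma 13] -/
theorem BurungaleFlach2024_main_cmField_iff_pPart (hR : Rubin1987_sha_primary_finite)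
    (h1 : CoatesWiles1977_L_one_div_period_mem_prime)
    (hH : hasEntireLFunction_of_j_mem_maximalCMJInvariants) (hBCL : LSeries_baseChange_quadratic)
    (hHW : ∀ (W : WeierstrassCurve ℚ) [W.IsElliptic] (ℓ : ℕ) [Fact ℓ.Prime],
      W.hasseWeilEulerFactor_geomPoints ℓ) :
    BurungaleFlach2024_main_cmField ↔ BurungaleFlach2024_main_cmField_pPart :=
  ⟨BurungaleFlach2024_main_cmField_pPart_of_main,
    fun hB => BurungaleFlach2024_main_cmField_of_six_leaves hB hR h1 hH hBCL hHW⟩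

/-- Bookkeeping: the census with modularity (`hasEntireLFunction_rat`, the leaf used by the
level-3/4/5 assemblies) in place of the Deuring–Hecke continuation, of which the latter is the
special case `hasEntireLFunction_of_j_mem_maximalCMJInvariants_of_hasEntireLFunction_rat`; this is
`BurungaleFlach2024_main_cmField_of_leaves` with its two discharged inputs (three singular moduli,
six twist isogenies) removed. [cite: BurungaleFlach2024, proof of Thm. 1.1 (§4.5)]
[cite: BCDTJAMS2001, Theorem A] -/
theorem BurungaleFlach2024_main_cmField_of_six_leaves_of_hasEntireLFunction_rat
    (hB : BurungaleFlach2024_main_cmField_pPart) (hR : Rubin1987_sha_primary_finite)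
    (h1 : CoatesWiles1977_L_one_div_period_mem_prime) (hmod : hasEntireLFunction_rat)
    (hBCL : LSeries_baseChange_quadratic)
    (hHW : ∀ (W : WeierstrassCurve ℚ) [W.IsElliptic] (ℓ : ℕ) [Fact ℓ.Prime],
      W.hasseWeilEulerFactor_geomPoints ℓ) :
    BurungaleFlach2024_main_cmField :=
  BurungaleFlach2024_main_cmField_of_six_leaves hB hR h1
    (hasEntireLFunction_of_j_mem_maximalCMJInvariants_of_hasEntireLFunction_rat hmod) hBCL hHW

end Literature.NumberTheory.EllipticCurves

end
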